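import Mathlib.Algebra.MvPolynomial.Monad
import Mathlib.Algebra.MvPolynomial.Funext
import Literature.Computability.AlgebraicComplexity.SparseCircuitBounds
import Literature.Computability.AlgebraicComplexity.IMMInVPProofs
import Literature.Computability.MetaComplexity.NWGenerator
import HarnessLib

/-!
# The Kabanets–Impagliazzo generator, I: an annihilated NW-type polynomial map forces a small
# algebraic dependence `H(x, f(x)) = 0` on the hard polynomial — the hybrid argument
# (Kabanets–Impagliazzo 2003, Lemma 30 part I; KRST 2022, Lemma 8)

Topic `Computability/AlgebraicComplexity` (hardness versus randomness for arithmetic circuits).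

**Printed statements.** Kabanets–Impagliazzo (STOC 2003 = Comput. Complexity 13 (2004)),
Algorithm 1 / Lemma 30: for an `m`-variate polynomial `p`, a design `S_1, …, S_n ⊆ [ℓ]`
(`|S_i| = m`, `|S_i ∩ S_j| ≤ log n`, their Lemma 10) and the polynomial map
`NW_p(a) = (p(a|_{S_1}), …, p(a|_{S_n}))`: if a nonzero `f ∈ 𝔽[y_1, …, y_n]` of degree `d_f` and
circuit size `s` vanishes on `NW_p(S^ℓ)`, `|S| > d_f d_p`, then `p` has circuits of size
`poly(n, d_f, d_p, s, M)`, `M ≤ (d_p + 1)^{log n}`. Proof: "I. Hybrid argument" — some hybrid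
`g_i ≢ 0`, `g_{i+1} ≡ 0`; fixing the irrelevant variables gives a nonzero `g(x_1, …, x_m, y)` of
size `≤ s + n · poly(M)` (each substituted copy of `p` is a restriction to `≤ log n` variables,
"at most `M` distinct monomials") with `g(x, p(x)) ≡ 0`; "II. Factoring" — `y - p(x)` is a factor
of `g` (Lemma 28, Gauss) so Kaltofen's theorem (their Thm. 27 / Cor. 29) bounds the size of `p`.
Kumar–Ramya–Saptharishi–Tengse (STACS 2022), Lemma 8 ("HSG from Hardness [KI04]"): for an
`(ℓ, m, n)`-design and an `m`-variate `f` of individual degree `d` requiring size `s`,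
`KI-gen(f) : y ↦ (f(y_{S_1}), …, f(y_{S_N}))` is a hitting set generator for circuits of size
`≤ s^{0.1} / (N (d+1)^n)`.

**What this file proves** (tree model: `complexity` = fan-in-two circuit size, constants free;
designs presented by block embeddings `e i : β ↪ α`, the tree's `IsNWDesign` of
`MetaComplexity/NWGenerator.lean`):

* `kiGenerator f e : ι → F[α]`, `i ↦ f(y|_{S_i}) = rename (e i) f` (KI's `NW_p`, KRST's
  `KI-gen(f)`), and `eval_kiGenerator`.
* The hybrids `kiHybrid f e S D = D(θ_S)` (`kiHybridSubst`: coordinates in `S` replaced by their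
  generator polynomial, the others free), `kiHybrid_empty_ne_zero`, `kiHybrid_univ`,
  `kiHybrid_insert` (one step = one substitution `kiStepSubst`), `exists_critical_kiHybrid`
  (some `g_S ≠ 0` with `g_{S ∪ {i}} = 0`).
* **Part I (hybrid argument), fully proved** — `exists_root_of_kiGenerator_annihilated`: over
  an infinite field, if the blocks pairwise meet in `≤ r` points (`IsNWDesign r e`), `D ≠ 0` and
  `D ∘ KI-gen(f) = 0` (`bind₁ (kiGenerator f e) D = 0`), then there is a NONZERO
  `H ∈ F[β ⊕ {c}]` (variables `Option β`, `c = none`) with `H(x, f(x)) = 0`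
  (`bind₁ (Option.elim · f X) H = 0`), `L(H) ≤ L(D) + #ι · (deg f + 1)^r (2 deg f + 2)` and
  `deg H ≤ deg D · max 1 (deg f)`.
* Part II (factoring: Gauss' lemma `c - f(x) ∣ H` and Kaltofen's factor theorem, taken as a
  hypothesis) and the resulting hitting-set-generator statement (KRST Lemma 8) are in
  `KabanetsImpagliazzoHardness.lean`; the sparse size bounds for the restricted copies are in
  `SparseCircuitBounds.lean`.

Not here: the choice of design parameters (the tree has `polyBlock` / `exists_isNWDesign`), the
succinctness of the generator's outputs (KRST §3.4; see
`Literature/Barriers/ValiantsHypothesis/AlgebraicNaturalProofsGenerators.lean` for where this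
enters the natural-proofs barrier), and Kaltofen's theorem itself.

## References

* [KabanetsImpagliazzo2003] V. Kabanets, R. Impagliazzo, *Derandomizing polynomial identity tests
  means proving circuit lower bounds*, STOC 2003 (Comput. Complexity 13 (2004) 1–46), Algorithm 1,
  Lemma 10, Thm. 27, Lemma 28, Cor. 29, Lemma 30.
* [KumarRamyaSaptharishiTengse2022] M. Kumar, C. Ramya, R. Saptharishi, A. Tengse, *If VNP is
  hard, then so are equations for it*, STACS 2022, Def. 5, Def. 7, Lemma 8.
* [Burgisser2024Completeness] P. Bürgisser, *Completeness classes in algebraic complexity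
  theory*, arXiv:2406.06217, Thm. 3.2 (Kaltofen).
-/

noncomputable section

namespace Literature.Computability.AlgebraicComplexity

open MvPolynomial Finset Literature.Computability.MetaComplexity

/-! ### The generator -/

section Generator

variable {F : Type*} [CommSemiring F] {ι α β : Type*}

/-- **The Kabanets–Impagliazzo generator `KI-gen(f)` / `NW_f`**: coordinate `i` is the hard
polynomial `f ∈ F[β]` read on the block `S_i = range (e i)` of the seed variables `α`,
`f(y|_{S_i}) = rename (e i) f`. [cite: KabanetsImpagliazzo2003, Algorithm 1] -/
def kiGenerator (f : MvPolynomial β F) (e : ι → (β ↪ α)) : ι → MvPolynomial α F :=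
  fun i => rename (e i) f

/-- Unfolding of `kiGenerator`. [cite: KabanetsImpagliazzo2003, Algorithm 1] -/
@[simp] theorem kiGenerator_apply (f : MvPolynomial β F) (e : ι → (β ↪ α)) (i : ι) :
    kiGenerator f e i = rename (e i) f := rfl

/-- The output of `KI-gen(f)` at a seed `a ∈ F^α`: coordinate `i` is `f(a|_{S_i})`.
[cite: KabanetsImpagliazzo2003, Algorithm 1] -/
theorem eval_kiGenerator (f : MvPolynomial β F) (e : ι → (β ↪ α)) (a : α → F) (i : ι) :
    eval a (kiGenerator f e i) = eval (a ∘ e i) f := by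
  rw [kiGenerator_apply, eval_rename]

/-- `bind₁ (X ∘ g) = rename g`. [folklore] -/
private theorem bind₁_X_comp {σ τ : Type*} (g : σ → τ) (φ : MvPolynomial σ F) :
    bind₁ (fun x => X (g x)) φ = rename g φ := by
  rw [rename_eq_aeval, aeval_eq_bind₁]; rfl

/-- `eval x (bind₁ h φ) = eval (eval x ∘ h) φ`. [folklore] -/
private theorem eval_bind₁' {σ τ : Type*} (x : τ → F) (h : σ → MvPolynomial τ F)
    (φ : MvPolynomial σ F) : eval x (bind₁ h φ) = eval (fun i => eval x (h i)) φ :=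
  eval₂Hom_bind₁ _ _ _ _

end Generator


/-! ### Part I: the hybrid argument (KI Lemma 30, I) -/

section Hybrid

variable {F : Type*} [CommSemiring F] {ι α β : Type*} [DecidableEq ι]

/-- The kiHybrid substitution `θ_S`: coordinates `j ∈ S` already replaced by `f(y|_{S_j})`
(in the seed variables `Sum.inl`), the others still free variables `c_j = X (Sum.inr j)`.
[cite: KabanetsImpagliazzo2003, Lemma 30 (proof, I)] -/
def kiHybridSubst (f : MvPolynomial β F) (e : ι → (β ↪ α)) (S : Finset ι) :
    ι → MvPolynomial (α ⊕ ι) F :=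
  fun j => if j ∈ S then rename Sum.inl (kiGenerator f e j) else X (Sum.inr j)

/-- The kiHybrid `g_S = D(θ_S)`: KI's `g_i` for `S` = the first `i` coordinates.
[cite: KabanetsImpagliazzo2003, Lemma 30 (proof, I)] -/
def kiHybrid (f : MvPolynomial β F) (e : ι → (β ↪ α)) (S : Finset ι) (D : MvPolynomial ι F) :
    MvPolynomial (α ⊕ ι) F :=
  bind₁ (kiHybridSubst f e S) D

/-- The one-step substitution `c_i ↦ f(y|_{S_i})` (all other variables fixed).
[cite: KabanetsImpagliazzo2003, Lemma 30 (proof, I)] -/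
def kiStepSubst (f : MvPolynomial β F) (e : ι → (β ↪ α)) (i : ι) :
    α ⊕ ι → MvPolynomial (α ⊕ ι) F :=
  Sum.elim (fun x => X (Sum.inl x))
    (fun j => if j = i then rename Sum.inl (kiGenerator f e i) else X (Sum.inr j))

/-- `g_∅` is `D` in the variables `c_j`: killing the seed variables recovers `D`, so `g_∅ ≠ 0`
when `D ≠ 0`. [cite: KabanetsImpagliazzo2003, Lemma 30 (proof, I)] -/
theorem kiHybrid_empty_ne_zero (f : MvPolynomial β F) (e : ι → (β ↪ α)) {D : MvPolynomial ι F}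
    (hD : D ≠ 0) : kiHybrid f e ∅ D ≠ 0 := by
  intro h0
  apply hD
  have hθ : kiHybridSubst f e ∅ = fun j => X (Sum.inr j) := by
    funext j; simp only [kiHybridSubst, Finset.notMem_empty, if_false]
  have h2 : (fun j : ι => bind₁ (Sum.elim (fun _ : α => (0 : MvPolynomial ι F)) X)
      (X (Sum.inr j) : MvPolynomial (α ⊕ ι) F)) = X := by
    funext j; rw [bind₁_X_right, Sum.elim_inr]
  have h1 : bind₁ (Sum.elim (fun _ : α => (0 : MvPolynomial ι F)) X) (kiHybrid f e ∅ D) = D := by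
    rw [kiHybrid, hθ, bind₁_bind₁, h2]
    exact (AlgHom.congr_fun bind₁_X_left D).trans (AlgHom.id_apply D)
  rw [← h1, h0, map_zero]

/-- `g_univ = (D ∘ KI-gen(f))` in the seed variables; so it vanishes when `D` annihilates the
generator. [cite: KabanetsImpagliazzo2003, Lemma 30 (proof, I)] -/
theorem kiHybrid_univ [Fintype ι] (f : MvPolynomial β F) (e : ι → (β ↪ α)) (D : MvPolynomial ι F) :
    kiHybrid f e Finset.univ D = rename Sum.inl (bind₁ (kiGenerator f e) D) := by
  have hθ : kiHybridSubst f e Finset.univ = fun j => rename Sum.inl (kiGenerator f e j) := by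
    funext j; simp only [kiHybridSubst, Finset.mem_univ, if_true]
  rw [kiHybrid, hθ, rename_bind₁]

/-- One kiHybrid step is a substitution: `g_{S ∪ {i}} = g_S[c_i ↦ f(y|_{S_i})]` (for `i ∉ S`
or not). [cite: KabanetsImpagliazzo2003, Lemma 30 (proof, I)] -/
theorem kiHybrid_insert (f : MvPolynomial β F) (e : ι → (β ↪ α)) (S : Finset ι) (i : ι)
    (D : MvPolynomial ι F) :
    kiHybrid f e (insert i S) D = bind₁ (kiStepSubst f e i) (kiHybrid f e S D) := by
  rw [kiHybrid, kiHybrid, bind₁_bind₁]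
  refine congrArg (fun θ => bind₁ θ D) (funext fun j => ?_)
  by_cases hjS : j ∈ S
  · have hj : j ∈ insert i S := Finset.mem_insert_of_mem hjS
    simp only [kiHybridSubst, if_pos hj, if_pos hjS, kiGenerator_apply]
    rw [bind₁_rename, show kiStepSubst f e i ∘ Sum.inl = fun x => X (Sum.inl x) from rfl,
      bind₁_X_comp]
  · by_cases hji : j = i
    · subst hji
      simp only [kiHybridSubst, Finset.mem_insert_self, if_true, if_neg hjS, bind₁_X_right,
        kiStepSubst, Sum.elim_inr]
    · have hj : j ∉ insert i S := by simp [hji, hjS]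
      simp only [kiHybridSubst, if_neg hj, if_neg hjS, bind₁_X_right, kiStepSubst, Sum.elim_inr,
        if_neg hji]

variable [Fintype ι]

/-- **The critical kiHybrid**: if `D ≠ 0` annihilates `KI-gen(f)` there are `S` and `i ∉ S` with
`g_S ≠ 0` and `g_{S ∪ {i}} = 0` (take `S` of maximal size with `g_S ≠ 0`; `S ≠ univ`).
[cite: KabanetsImpagliazzo2003, Lemma 30 (proof, I)] -/
theorem exists_critical_kiHybrid (f : MvPolynomial β F) (e : ι → (β ↪ α)) {D : MvPolynomial ι F}
    (hD : D ≠ 0) (hann : bind₁ (kiGenerator f e) D = 0) :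
    ∃ (S : Finset ι) (i : ι), i ∉ S ∧ kiHybrid f e S D ≠ 0 ∧ kiHybrid f e (insert i S) D = 0 := by
  classical
  set good : Finset (Finset ι) := Finset.univ.filter fun S => kiHybrid f e S D ≠ 0 with hgood
  have hne : good.Nonempty := ⟨∅, by simpa [hgood] using kiHybrid_empty_ne_zero f e hD⟩
  obtain ⟨S, hS, hmax⟩ := Finset.exists_max_image good Finset.card hne
  have hS' : kiHybrid f e S D ≠ 0 := by simpa [hgood] using hS
  have hSu : S ≠ Finset.univ := by
    rintro rfl
    exact hS' (by rw [kiHybrid_univ, hann, map_zero])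
  obtain ⟨i, -, hi⟩ := Finset.exists_of_ssubset (Finset.ssubset_univ_iff.2 hSu)
  refine ⟨S, i, hi, hS', ?_⟩
  by_contra hne'
  have hmem : insert i S ∈ good := by simpa [hgood] using hne'
  have := hmax _ hmem
  rw [Finset.card_insert_of_notMem hi] at this
  omega

end Hybrid

section HybridField

variable {F : Type*} [Field F] [Infinite F] {ι α β : Type*}
  [Fintype ι] [DecidableEq ι] [Fintype β] [DecidableEq β] [DecidableEq α]

/-- **KI Lemma 30, part I (hybrid argument) — PROVED.** Let the blocks of `e` pairwise meet in
at most `r` points. If a nonzero `D ∈ F[c_i : i ∈ ι]` annihilates `KI-gen(f)` then `f` is a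
ROOT of a nonzero polynomial of controlled size and degree: there is `H ∈ F[x_b, c]`
(variables `Option β`, `c = none`) with `H ≠ 0`, `H(x, f(x)) = 0`,
`L(H) ≤ L(D) + #ι · (deg f + 1)^r · (2 deg f + 2)` and `deg H ≤ deg D · max 1 (deg f)`.
(Fix the seed variables outside the block `S_i` of the critical kiHybrid, and the remaining free
coordinates, at a point where `g_S` does not vanish — infinite field; every substituted copy
`f(y|_{S_j})`, `j ≠ i`, keeps only its `≤ r` variables inside `S_i`.)
[cite: KabanetsImpagliazzo2003, Lemma 30 (proof, I)] -/
theorem exists_root_of_kiGenerator_annihilated {r : ℕ} {e : ι → (β ↪ α)} (he : IsNWDesign r e)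
    (f : MvPolynomial β F) {D : MvPolynomial ι F} (hD : D ≠ 0)
    (hann : bind₁ (kiGenerator f e) D = 0) :
    ∃ H : MvPolynomial (Option β) F, H ≠ 0 ∧ bind₁ (fun o => o.elim f X) H = 0 ∧
      complexity H ≤ complexity D +
        Fintype.card ι * ((f.totalDegree + 1) ^ r * (2 * f.totalDegree + 2)) ∧
      H.totalDegree ≤ D.totalDegree * max 1 f.totalDegree := by
  classical
  obtain ⟨S, i, hiS, hS, hSi⟩ := exists_critical_kiHybrid f e hD hann
  -- a point where the critical kiHybrid does not vanish
  obtain ⟨v, hv⟩ : ∃ v : α ⊕ ι → F, eval v (kiHybrid f e S D) ≠ 0 := by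
    by_contra hcon
    push Not at hcon
    exact hS (MvPolynomial.funext fun v => by rw [hcon v, map_zero])
  -- the specialisation keeping the block of `i` and the coordinate `c_i` free
  set ψ : α ⊕ ι → MvPolynomial (Option β) F := Sum.elim
    (fun x => if h : ∃ b, e i b = x then X (some h.choose) else C (v (Sum.inl x)))
    (fun j => if j = i then X none else C (v (Sum.inr j))) with hψ
  have hψe : ∀ b, ψ (Sum.inl (e i b)) = X (some b) := by
    intro b
    have h : ∃ b', e i b' = e i b := ⟨b, rfl⟩
    have hc : h.choose = b := (e i).injective h.choose_spec
    simp only [hψ, Sum.elim_inl, dif_pos h, hc]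
  have hψi : ψ (Sum.inr i) = X none := by simp only [hψ, Sum.elim_inr, if_true]
  -- the restricted copies, for `j ≠ i`
  have hrestr : ∀ j, j ≠ i → complexity (bind₁ ψ (rename Sum.inl (rename (e j) f))) ≤
      (f.totalDegree + 1) ^ r * (2 * f.totalDegree + 2) := by
    intro j hji
    rw [bind₁_rename, bind₁_rename, ← aeval_eq_bind₁]
    refine complexity_aeval_restrict_le f _
      (Finset.univ.filter fun b => ∃ b', e i b' = e j b)
      (fun b => if h : ∃ b', e i b' = e j b then some h.choose else none)
      (fun b => v (Sum.inl (e j b))) ?_ ?_ ?_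
    · intro b hb
      have h : ∃ b', e i b' = e j b := (Finset.mem_filter.1 hb).2
      simp only [Function.comp_apply, hψ, Sum.elim_inl, dif_pos h]
    · intro b hb
      have h : ¬ ∃ b', e i b' = e j b := fun h => hb (Finset.mem_filter.2 ⟨Finset.mem_univ _, h⟩)
      simp only [Function.comp_apply, hψ, Sum.elim_inl, dif_neg h]
    · -- design: the live positions inject into `S_j ∩ S_i`
      refine le_trans ?_ (he hji)
      rw [← Finset.card_map (e j)]
      refine Finset.card_le_card fun x hx => ?_
      rw [Finset.mem_map] at hx
      obtain ⟨b, hb, rfl⟩ := hx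
      obtain ⟨b', hb'⟩ := (Finset.mem_filter.1 hb).2
      rw [Finset.mem_inter, Finset.mem_map, Finset.mem_map]
      exact ⟨⟨b, Finset.mem_univ _, rfl⟩, ⟨b', Finset.mem_univ _, hb'⟩⟩
  refine ⟨bind₁ ψ (kiHybrid f e S D), ?_, ?_, ?_, ?_⟩
  · -- (a) nonzero: evaluate at the matching point
    set w : Option β → F := fun o => o.elim (v (Sum.inr i)) fun b => v (Sum.inl (e i b)) with hw
    have hwψ : ∀ u, eval w (ψ u) = v u := by
      rintro (x | j)
      · by_cases h : ∃ b, e i b = x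
        · simp only [hψ, Sum.elim_inl, dif_pos h, eval_X, hw, Option.elim_some]
          rw [h.choose_spec]
        · simp only [hψ, Sum.elim_inl, dif_neg h, eval_C]
      · by_cases hj : j = i
        · subst hj; simp only [hψi, eval_X, hw, Option.elim_none]
        · simp only [hψ, Sum.elim_inr, if_neg hj, eval_C]
    intro h0
    apply hv
    have h1 := congrArg (eval w) h0
    rw [map_zero, eval_bind₁', show (fun u => eval w (ψ u)) = v from funext hwψ] at h1
    exact h1
  · -- (b) root: substituting `c ↦ f(x)` factors through the (vanishing) next kiHybrid
    set ρ : Option β → MvPolynomial β F := fun o => o.elim f X with hρ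
    have key : ∀ u, bind₁ (fun u => bind₁ ρ (ψ u)) (kiStepSubst f e i u) = bind₁ ρ (ψ u) := by
      rintro (x | j)
      · simp only [kiStepSubst, Sum.elim_inl, bind₁_X_right]
      · by_cases hj : j = i
        · subst hj
          simp only [kiStepSubst, Sum.elim_inr, if_true, kiGenerator_apply]
          rw [bind₁_rename, bind₁_rename, hψi, bind₁_X_right]
          have hcomp : ((fun u => bind₁ ρ (ψ u)) ∘ Sum.inl) ∘ (e j) = X := by
            funext b
            simp only [Function.comp_apply, hψe b, bind₁_X_right, hρ, Option.elim_some]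
          rw [hcomp]
          exact (AlgHom.congr_fun bind₁_X_left f).trans (AlgHom.id_apply f)
        · simp only [kiStepSubst, Sum.elim_inr, if_neg hj, bind₁_X_right]
    have h2 : bind₁ (fun u => bind₁ ρ (ψ u)) (kiHybrid f e (insert i S) D) =
        bind₁ ρ (bind₁ ψ (kiHybrid f e S D)) := by
      rw [kiHybrid_insert, bind₁_bind₁, bind₁_bind₁]
      exact congrArg (fun θ => bind₁ θ (kiHybrid f e S D)) (funext key)
    rw [← h2, hSi, map_zero]
  · -- (c) size
    rw [kiHybrid, bind₁_bind₁, ← aeval_eq_bind₁]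
    refine (complexity_aeval_le _ _).trans (Nat.add_le_add_left ?_ _)
    calc ∑ j, complexity (bind₁ ψ (kiHybridSubst f e S j))
        ≤ ∑ _j : ι, (f.totalDegree + 1) ^ r * (2 * f.totalDegree + 2) := by
          refine Finset.sum_le_sum fun j _ => ?_
          by_cases hjS : j ∈ S
          · have hji : j ≠ i := fun h => hiS (h ▸ hjS)
            simp only [kiHybridSubst, if_pos hjS, kiGenerator_apply]
            exact hrestr j hji
          · have h0 : complexity (bind₁ ψ (kiHybridSubst f e S j)) = 0 := by
              simp only [kiHybridSubst, if_neg hjS, bind₁_X_right]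
              by_cases hji : j = i
              · rw [hji, hψi]; exact complexity_X_holds (k := F) _
              · simp only [hψ, Sum.elim_inr, if_neg hji]; exact complexity_C_holds _
            rw [h0]; exact Nat.zero_le _
      _ = Fintype.card ι * ((f.totalDegree + 1) ^ r * (2 * f.totalDegree + 2)) := by
          rw [Finset.sum_const, smul_eq_mul, Finset.card_univ]
  · -- (d) degree
    rw [kiHybrid, bind₁_bind₁, ← aeval_eq_bind₁]
    refine Literature.RingTheory.Nullstellensatz.totalDegree_aeval_le _ (fun j => ?_) D
    by_cases hjS : j ∈ S
    · simp only [kiHybridSubst, if_pos hjS, kiGenerator_apply]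
      rw [bind₁_rename, bind₁_rename, ← aeval_eq_bind₁]
      refine (Literature.RingTheory.Nullstellensatz.totalDegree_aeval_le _ (δ := 1)
        (fun b => ?_) f).trans (by simp)
      simp only [Function.comp_apply, hψ, Sum.elim_inl]
      split_ifs
      · exact (isHomogeneous_X F _).totalDegree_le
      · rw [totalDegree_C]; exact Nat.zero_le _
    · simp only [kiHybridSubst, if_neg hjS, bind₁_X_right]
      by_cases hji : j = i
      · rw [hji, hψi]; exact ((isHomogeneous_X F _).totalDegree_le).trans (le_max_left _ _)
      · simp only [hψ, Sum.elim_inr, if_neg hji, totalDegree_C]; exact Nat.zero_le _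

end HybridField

end Literature.Computability.AlgebraicComplexity

end
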